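import Summits.BirchSwinnertonDyer.BirchSwinnertonDyer.Theorems.KimAtThreeFineKatoDefinedLambdaExpStarDefs
import Literature.NumberTheory.AdelicBaseChange.PadicTensorCompletionProofs
import Literature.NumberTheory.AdelicBaseChange.PadicTensorCompletionGaloisProofs
import HarnessLib

/-!
# The scale law of Kato's DEFINED value datum: `katoLambda` of the rescaled Néron line `c • dw` is
# `q • katoLambda dw` when `e_p(q) = c⁻¹`
# (cell `bsd-addord`, seat w2-acc4 gen 6; crux `KatoKuriharaPortThreeShared` = stmt-BirchSwinnertonDyer-19560;
# `--supports 19560`, helper)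

HONEST FRAMING.  ONE tool theorem about w2-acc5 gen 6's definition `katoLambda`
(`KimAtThreeFineKatoDefinedLambdaExpStarDefs`, p526036); no definition, no named fact, no instance, no `sorry`;
closes nothing; BSD / 19560 NOT proved by this file.

WHAT.  `katoLambda W p k r w₀ Ψ hΨ hw₀ g hg dw hinjw hexw : H¹(U_{k,r}, T_pW) →ₗ[ℤ_p] ℚ_p ⊗ ℚ(ζ_m)` reads Kato's
`exp* ∘ loc_p` in the coordinate of a local Néron line `dw` at `L_{w₀}`.  Rescaling the line by a scalar of the base,
`dw ↦ (algebraMap ℚ_v L_{w₀} c) • dw` (`c ∈ ℚ_vˣ`), multiplies `exp*_{w₀}` by `c⁻¹` (w2-c2 `expStarOmega_smul`); the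
transports `(g̃_w⁻¹)_*` are `ℚ_v`-linear (w2-acc5 `galAdicCompletionMap_algebraMap_adicCompletion`) and `Ψ` reads the
`ℚ_p`-action through `e_p` (w2-acc4 `padicTensor_map_smul`), so for the rational `q` with `e_p(q) = c⁻¹`:

  `katoLambda_smul_line : katoLambda … ((algebraMap c) • dw) … y = (q : ℚ_p) • katoLambda … dw … y`.

This is the covariance input `hcov` of w2-acc4's OUTER rescaling lemma
(`KimAtThreeFineKatoOuterRescale.exists_dual_unit_of_position`) for any displayed package whose value datum IS
`katoLambda` (acc5's hKatoDef road): with it the duality ASSERTION and the Prop-1.2.3 binders of such a package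
are removable from 19560's residual in favour of the position clause POS, exactly as `KimAtThreeFineKatoPosition`
does for kim3's hKatoV2₀.

References: K. Kato, Astérisque 295 (2004) §9.4 p. 188, Thm. 9.7 p. 189 [Kato2004Asterisque]; K. Kato, LNM 1553 (1993)
II §1.2.4 [Kato1993LNM1553]; J. W. S. Cassels, A. Fröhlich (1967) Ch. II §10 (10.2), Ch. VII §1.1 [CasselsFrohlichANT1967].
-/

noncomputable section

-- the cell's Theorems namespace `Summit.BirchSwinnertonDyer.BirchSwinnertonDyer.…` repeats the summit name by design (D-0017)
set_option linter.dupNamespace false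

open scoped Classical NumberField ContRepresentation TensorProduct Pointwise
open Field ValuativeRel NumberField IsDedekindDomain
open WeierstrassCurve Literature.NumberTheory.EllipticCurves Literature.NumberTheory.GaloisRepresentations
  Literature.NumberTheory.GaloisRepresentations.DiscreteGaloisModule
  Literature.NumberTheory.EllipticCurves.Kato2004.EulerSystemValues
open Literature.NumberTheory.GaloisRepresentations.PeriodRingData Literature.NumberTheory.PAdicHodge
open Literature.NumberTheory.AdelicBaseChange Literature.NumberTheory.Automorphic
open Summit.BirchSwinnertonDyer.Rank1Residual.GaloisImage
open Summit.BirchSwinnertonDyer.BirchSwinnertonDyer.Theorems.KimAtThreeDeepLowerExpStarOmega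
open Summit.BirchSwinnertonDyer.BirchSwinnertonDyer.Theorems.KimAtThreeDeepLowerExpStarOmegaPlace
open Summit.BirchSwinnertonDyer.BirchSwinnertonDyer.Theorems.KimAtThreeFineKatoDefinedLambda

namespace Summit.BirchSwinnertonDyer.BirchSwinnertonDyer.Theorems.KimAtThreeFineKatoDefinedLambdaRescale

variable (W : WeierstrassCurve ℚ) [W.IsElliptic] (p : ℕ) [hp : Fact p.Prime]
  [ContinuousSMul ℤ_[p] (W.tateModule p)] (k : ℕ) (r : Finset (HeightOneSpectrum (𝓞 ℚ)))
  (w₀ : ((Rat.HeightOneSpectrum.primesEquiv (R := 𝓞 ℚ)).symm ⟨p, Fact.out⟩).Extension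
    (𝓞 (CyclotomicField (cycLevel p k r) ℚ)))
  (Ψ : ℚ_[p] ⊗[ℚ] CyclotomicField (cycLevel p k r) ℚ ≃ₐ[ℚ]
    (Π w : ((Rat.HeightOneSpectrum.primesEquiv (R := 𝓞 ℚ)).symm ⟨p, Fact.out⟩).Extension
      (𝓞 (CyclotomicField (cycLevel p k r) ℚ)), w.1.adicCompletion (CyclotomicField (cycLevel p k r) ℚ)))
  (hΨ : ∀ (s : ℚ_[p]) (x : CyclotomicField (cycLevel p k r) ℚ)
    (w : ((Rat.HeightOneSpectrum.primesEquiv (R := 𝓞 ℚ)).symm ⟨p, Fact.out⟩).Extension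
      (𝓞 (CyclotomicField (cycLevel p k r) ℚ))),
    Ψ (s ⊗ₜ[ℚ] x) w = algebraMap (CyclotomicField (cycLevel p k r) ℚ)
        (w.1.adicCompletion (CyclotomicField (cycLevel p k r) ℚ)) x *
      algebraMap (((Rat.HeightOneSpectrum.primesEquiv (R := 𝓞 ℚ)).symm ⟨p, Fact.out⟩).adicCompletion ℚ)
        (w.1.adicCompletion (CyclotomicField (cycLevel p k r) ℚ)) (Padic.adicCompletionEquiv (𝓞 ℚ) ⟨p, Fact.out⟩ s))
  (hw₀ : ((p : ℕ) : 𝓞 (CyclotomicField (cycLevel p k r) ℚ)) ∈ w₀.1.asIdeal)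
  (g : ((Rat.HeightOneSpectrum.primesEquiv (R := 𝓞 ℚ)).symm ⟨p, Fact.out⟩).Extension
    (𝓞 (CyclotomicField (cycLevel p k r) ℚ)) → absoluteGaloisGroup ℚ)
  (hg : ∀ w : ((Rat.HeightOneSpectrum.primesEquiv (R := 𝓞 ℚ)).symm ⟨p, Fact.out⟩).Extension
      (𝓞 (CyclotomicField (cycLevel p k r) ℚ)),
    sigma (cycLevel p k r) (modNCyclotomicCharacter ℚ (cycLevel p k r) (g w)) • w.1 = w₀.1)

set_option backward.isDefEq.respectTransparency false in
set_option maxHeartbeats 400000 in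
/-- **Scale law of the defined value datum**: for `c ∈ ℚ_vˣ` and the rational `q` with `e_p(q) = c⁻¹`
(`e_p = Padic.adicCompletionEquiv`), `katoLambda` of the rescaled line `(algebraMap c) • dw` is `q • katoLambda dw`
(pointwise).  Ingredients: `apply_katoLambda` (class-level (DEF₀)), `expStarTowerMap_apply`, w2-c2's
`expStarOmega_smul` (`exp*_{e•ω} = e⁻¹ exp*_ω`), `galAdicCompletionMap_algebraMap_adicCompletion` (`ℚ_v`-linearity of
the transports), `padicTensor_map_smul` (`Ψ (s • t)_w = e_p(s) · Ψ(t)_w`).  (`maxHeartbeats 400000`: the displayed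
`letI` instance block of `katoLambda`'s type, as in acc5's `expStarTowerMap_smul`.)
[cite: Kato2004Asterisque, §9.4 (p. 188)] [cite: Kato1993LNM1553, Ch. II §1.2.4]
[cite: CasselsFrohlichANT1967, Ch. II §10 Theorem (10.2) and Ch. VII §1.1] -/
theorem katoLambda_smul_line
    (c : ((Rat.HeightOneSpectrum.primesEquiv (R := 𝓞 ℚ)).symm ⟨p, Fact.out⟩).adicCompletion ℚ) (q : ℚ)
    (hq : Padic.adicCompletionEquiv (𝓞 ℚ) ⟨p, Fact.out⟩ (q : ℚ_[p]) = c⁻¹) :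
    letI := LocalField.charZero_adicCompletion w₀.1
    letI := LocalField.adicCompletionPadicAlgebra w₀.1 p hw₀
    haveI : Fact (¬ IsUnit ((p : ℕ) : integerC (w₀.1.adicCompletion (CyclotomicField (cycLevel p k r) ℚ)))) :=
      ⟨not_isUnit_natCast_integerC (LocalField.valuation_adicCompletion_natCast_lt_one w₀.1 p hw₀)⟩
    haveI := isAdicComplete_integerC_natCast (LocalField.valuation_adicCompletion_natCast_lt_one w₀.1 p hw₀)
    ∀ (dw : LocalNeronLine W (LocalField.valuation_adicCompletion_natCast_lt_one w₀.1 p hw₀)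
        ((galRestrictPlace ((Rat.HeightOneSpectrum.primesEquiv (R := 𝓞 ℚ)).symm ⟨p, Fact.out⟩)).comp
          (absGaloisRestrict (((Rat.HeightOneSpectrum.primesEquiv (R := 𝓞 ℚ)).symm ⟨p, Fact.out⟩).adicCompletion ℚ)
            (w₀.1.adicCompletion (CyclotomicField (cycLevel p k r) ℚ)))))
      (hinjw : (bdRPeriodRingData (LocalField.valuation_adicCompletion_natCast_lt_one w₀.1 p hw₀)).CupLogInjective
        (logCyclotomic p) (localRationalTateRep W p ((galRestrictPlace ((Rat.HeightOneSpectrum.primesEquiv (R := 𝓞 ℚ)).symm ⟨p, Fact.out⟩)).comp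
          (absGaloisRestrict (((Rat.HeightOneSpectrum.primesEquiv (R := 𝓞 ℚ)).symm ⟨p, Fact.out⟩).adicCompletion ℚ)
            (w₀.1.adicCompletion (CyclotomicField (cycLevel p k r) ℚ))))))
      (hexw : ∀ z : contOneCocycles (localRationalTateRep W p ((galRestrictPlace ((Rat.HeightOneSpectrum.primesEquiv (R := 𝓞 ℚ)).symm ⟨p, Fact.out⟩)).comp
          (absGaloisRestrict (((Rat.HeightOneSpectrum.primesEquiv (R := 𝓞 ℚ)).symm ⟨p, Fact.out⟩).adicCompletion ℚ)
            (w₀.1.adicCompletion (CyclotomicField (cycLevel p k r) ℚ))))).toTopRep,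
        (bdRPeriodRingData (LocalField.valuation_adicCompletion_natCast_lt_one w₀.1 p hw₀)).HasDualExp
          (logCyclotomic p) (localRationalTateRep W p ((galRestrictPlace ((Rat.HeightOneSpectrum.primesEquiv (R := 𝓞 ℚ)).symm ⟨p, Fact.out⟩)).comp
          (absGaloisRestrict (((Rat.HeightOneSpectrum.primesEquiv (R := 𝓞 ℚ)).symm ⟨p, Fact.out⟩).adicCompletion ℚ)
            (w₀.1.adicCompletion (CyclotomicField (cycLevel p k r) ℚ))))) fun σ => z.1 σ)
      (hcw : algebraMap (((Rat.HeightOneSpectrum.primesEquiv (R := 𝓞 ℚ)).symm ⟨p, Fact.out⟩).adicCompletion ℚ)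
        (w₀.1.adicCompletion (CyclotomicField (cycLevel p k r) ℚ)) c ≠ 0)
      (y : H1 (tateRep W p) (cycSubgroup p k r)),
      katoLambda W p k r w₀ Ψ hΨ hw₀ g hg (dw.smul _ hcw) hinjw hexw y =
        (q : ℚ_[p]) • katoLambda W p k r w₀ Ψ hΨ hw₀ g hg dw hinjw hexw y := by
  intro dw hinjw hexw hcw y
  letI := LocalField.charZero_adicCompletion w₀.1
  letI := LocalField.adicCompletionPadicAlgebra w₀.1 p hw₀
  haveI : Fact (¬ IsUnit ((p : ℕ) : integerC (w₀.1.adicCompletion (CyclotomicField (cycLevel p k r) ℚ)))) :=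
    ⟨not_isUnit_natCast_integerC (LocalField.valuation_adicCompletion_natCast_lt_one w₀.1 p hw₀)⟩
  haveI := isAdicComplete_integerC_natCast (LocalField.valuation_adicCompletion_natCast_lt_one w₀.1 p hw₀)
  apply Ψ.injective
  funext w
  have hsm := padicTensor_map_smul (Ψ : _ →ₐ[ℚ] _) (fun s x w => hΨ s x w) (q : ℚ_[p])
    (katoLambda W p k r w₀ Ψ hΨ hw₀ g hg dw hinjw hexw y) w
  simp only [AlgEquiv.coe_toAlgHom] at hsm
  rw [hsm, apply_katoLambda, apply_katoLambda, expStarTowerMap_apply, expStarTowerMap_apply, expStarOmegaHom_apply,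
    expStarOmegaHom_apply, expStarOmega_smul, map_mul, map_inv₀,
    galAdicCompletionMap_algebraMap_adicCompletion _ _ w₀ w (inv_smul_eq_of_smul_eq (hg w)), hq, map_inv₀]

set_option backward.isDefEq.respectTransparency false in
set_option maxHeartbeats 400000 in
/-- **The rescaled line as a PACKAGE** (consumer form of `katoLambda_smul_line`, for the LEAD's universal-chart shape hKatoFin):
for `c ∈ ℚ_vˣ` and the rational `q ≠ 0` with `e_p(q) = c⁻¹` there is a line datum `dw'` (namely `c⁻¹ • dw`) with
(i) `exp*_{dw'} = (algebraMap c) · exp*_{dw}` (w2-c2 `expStarOmega_smul`) and (ii) for every class `y` and value `x`,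
`katoLambda … dw' … y = 1 ⊗ₜ x → katoLambda … dw … y = 1 ⊗ₜ (q • x)`.  Stated in THIS file's elaboration context on purpose:
a consumer that re-derives (ii) next to a displayed package elaborated elsewhere hits `isDefEq`/`whnf` time-outs on the
`ℚ_p ⊗ ℚ(ζ_m)` instance paths; consuming (i)/(ii) BY NAME avoids building any such term.
[cite: Kato2004Asterisque, §9.4 (p. 188)] [cite: Kato1993LNM1553, Ch. II §1.2.4]
[cite: CasselsFrohlichANT1967, Ch. II §10 Theorem (10.2) and Ch. VII §1.1] -/
theorem exists_rescaled_line
    (c : ((Rat.HeightOneSpectrum.primesEquiv (R := 𝓞 ℚ)).symm ⟨p, Fact.out⟩).adicCompletion ℚ) (hc : c ≠ 0) (q : ℚ) (hq0 : q ≠ 0)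
    (hq : Padic.adicCompletionEquiv (𝓞 ℚ) ⟨p, Fact.out⟩ (q : ℚ_[p]) = c⁻¹) :
    letI := LocalField.charZero_adicCompletion w₀.1
    letI := LocalField.adicCompletionPadicAlgebra w₀.1 p hw₀
    haveI : Fact (¬ IsUnit ((p : ℕ) : integerC (w₀.1.adicCompletion (CyclotomicField (cycLevel p k r) ℚ)))) :=
      ⟨not_isUnit_natCast_integerC (LocalField.valuation_adicCompletion_natCast_lt_one w₀.1 p hw₀)⟩
    haveI := isAdicComplete_integerC_natCast (LocalField.valuation_adicCompletion_natCast_lt_one w₀.1 p hw₀)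
    ∀ (dw : LocalNeronLine W (LocalField.valuation_adicCompletion_natCast_lt_one w₀.1 p hw₀)
        ((galRestrictPlace ((Rat.HeightOneSpectrum.primesEquiv (R := 𝓞 ℚ)).symm ⟨p, Fact.out⟩)).comp
          (absGaloisRestrict (((Rat.HeightOneSpectrum.primesEquiv (R := 𝓞 ℚ)).symm ⟨p, Fact.out⟩).adicCompletion ℚ) (w₀.1.adicCompletion (CyclotomicField (cycLevel p k r) ℚ)))))
      (hinjw : (bdRPeriodRingData (LocalField.valuation_adicCompletion_natCast_lt_one w₀.1 p hw₀)).CupLogInjective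
        (logCyclotomic p) (localRationalTateRep W p ((galRestrictPlace ((Rat.HeightOneSpectrum.primesEquiv (R := 𝓞 ℚ)).symm ⟨p, Fact.out⟩)).comp
          (absGaloisRestrict (((Rat.HeightOneSpectrum.primesEquiv (R := 𝓞 ℚ)).symm ⟨p, Fact.out⟩).adicCompletion ℚ) (w₀.1.adicCompletion (CyclotomicField (cycLevel p k r) ℚ))))))
      (hexw : ∀ z : contOneCocycles (localRationalTateRep W p ((galRestrictPlace ((Rat.HeightOneSpectrum.primesEquiv (R := 𝓞 ℚ)).symm ⟨p, Fact.out⟩)).comp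
          (absGaloisRestrict (((Rat.HeightOneSpectrum.primesEquiv (R := 𝓞 ℚ)).symm ⟨p, Fact.out⟩).adicCompletion ℚ) (w₀.1.adicCompletion (CyclotomicField (cycLevel p k r) ℚ))))).toTopRep,
        (bdRPeriodRingData (LocalField.valuation_adicCompletion_natCast_lt_one w₀.1 p hw₀)).HasDualExp
          (logCyclotomic p) (localRationalTateRep W p ((galRestrictPlace ((Rat.HeightOneSpectrum.primesEquiv (R := 𝓞 ℚ)).symm ⟨p, Fact.out⟩)).comp
          (absGaloisRestrict (((Rat.HeightOneSpectrum.primesEquiv (R := 𝓞 ℚ)).symm ⟨p, Fact.out⟩).adicCompletion ℚ) (w₀.1.adicCompletion (CyclotomicField (cycLevel p k r) ℚ))))) fun σ => z.1 σ),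
      ∃ dw' : LocalNeronLine W (LocalField.valuation_adicCompletion_natCast_lt_one w₀.1 p hw₀)
          ((galRestrictPlace ((Rat.HeightOneSpectrum.primesEquiv (R := 𝓞 ℚ)).symm ⟨p, Fact.out⟩)).comp
            (absGaloisRestrict (((Rat.HeightOneSpectrum.primesEquiv (R := 𝓞 ℚ)).symm ⟨p, Fact.out⟩).adicCompletion ℚ) (w₀.1.adicCompletion (CyclotomicField (cycLevel p k r) ℚ)))),
        (∀ X, expStarOmegaHom (LocalField.valuation_adicCompletion_natCast_lt_one w₀.1 p hw₀)
            ((galRestrictPlace ((Rat.HeightOneSpectrum.primesEquiv (R := 𝓞 ℚ)).symm ⟨p, Fact.out⟩)).comp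
              (absGaloisRestrict (((Rat.HeightOneSpectrum.primesEquiv (R := 𝓞 ℚ)).symm ⟨p, Fact.out⟩).adicCompletion ℚ) (w₀.1.adicCompletion (CyclotomicField (cycLevel p k r) ℚ))))
            dw' hinjw hexw X =
          algebraMap (((Rat.HeightOneSpectrum.primesEquiv (R := 𝓞 ℚ)).symm ⟨p, Fact.out⟩).adicCompletion ℚ) (w₀.1.adicCompletion (CyclotomicField (cycLevel p k r) ℚ)) c *
            expStarOmegaHom (LocalField.valuation_adicCompletion_natCast_lt_one w₀.1 p hw₀)
              ((galRestrictPlace ((Rat.HeightOneSpectrum.primesEquiv (R := 𝓞 ℚ)).symm ⟨p, Fact.out⟩)).comp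
                (absGaloisRestrict (((Rat.HeightOneSpectrum.primesEquiv (R := 𝓞 ℚ)).symm ⟨p, Fact.out⟩).adicCompletion ℚ) (w₀.1.adicCompletion (CyclotomicField (cycLevel p k r) ℚ))))
              dw hinjw hexw X) ∧
        ∀ (x : CyclotomicField (cycLevel p k r) ℚ) (y : H1 (tateRep W p) (cycSubgroup p k r)),
          katoLambda W p k r w₀ Ψ hΨ hw₀ g hg dw' hinjw hexw y = (1 : ℚ_[p]) ⊗ₜ[ℚ] x →
          katoLambda W p k r w₀ Ψ hΨ hw₀ g hg dw hinjw hexw y = (1 : ℚ_[p]) ⊗ₜ[ℚ] (q • x) := by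
  intro dw hinjw hexw
  letI := LocalField.charZero_adicCompletion w₀.1
  letI := LocalField.adicCompletionPadicAlgebra w₀.1 p hw₀
  haveI : Fact (¬ IsUnit ((p : ℕ) : integerC (w₀.1.adicCompletion (CyclotomicField (cycLevel p k r) ℚ)))) :=
    ⟨not_isUnit_natCast_integerC (LocalField.valuation_adicCompletion_natCast_lt_one w₀.1 p hw₀)⟩
  haveI := isAdicComplete_integerC_natCast (LocalField.valuation_adicCompletion_natCast_lt_one w₀.1 p hw₀)
  have hcw : algebraMap (((Rat.HeightOneSpectrum.primesEquiv (R := 𝓞 ℚ)).symm ⟨p, Fact.out⟩).adicCompletion ℚ) (w₀.1.adicCompletion (CyclotomicField (cycLevel p k r) ℚ)) c ≠ 0 :=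
    (map_ne_zero_iff _ (algebraMap (((Rat.HeightOneSpectrum.primesEquiv (R := 𝓞 ℚ)).symm ⟨p, Fact.out⟩).adicCompletion ℚ)
      (w₀.1.adicCompletion (CyclotomicField (cycLevel p k r) ℚ))).injective).mpr hc
  have hcw' : algebraMap (((Rat.HeightOneSpectrum.primesEquiv (R := 𝓞 ℚ)).symm ⟨p, Fact.out⟩).adicCompletion ℚ) (w₀.1.adicCompletion (CyclotomicField (cycLevel p k r) ℚ)) c⁻¹ ≠ 0 :=
    (map_ne_zero_iff _ (algebraMap (((Rat.HeightOneSpectrum.primesEquiv (R := 𝓞 ℚ)).symm ⟨p, Fact.out⟩).adicCompletion ℚ)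
      (w₀.1.adicCompletion (CyclotomicField (cycLevel p k r) ℚ))).injective).mpr (inv_ne_zero hc)
  have hq' : Padic.adicCompletionEquiv (𝓞 ℚ) ⟨p, Fact.out⟩ ((q⁻¹ : ℚ) : ℚ_[p]) = c⁻¹⁻¹ := by
    rw [Rat.cast_inv, map_inv₀, hq]
  have hqp : ((q : ℚ) : ℚ_[p]) ≠ 0 := by exact_mod_cast hq0
  refine ⟨dw.smul _ hcw', fun X => ?_, fun x y hy => ?_⟩
  · rw [expStarOmegaHom_apply, expStarOmegaHom_apply, expStarOmega_smul, map_inv₀, inv_inv]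
  · have hsc := katoLambda_smul_line W p k r w₀ Ψ hΨ hw₀ g hg c⁻¹ q⁻¹ hq' dw hinjw hexw hcw' y
    rw [hsc] at hy
    have hqq : (q : ℚ_[p]) * ((q⁻¹ : ℚ) : ℚ_[p]) = 1 := by rw [Rat.cast_inv, mul_inv_cancel₀ hqp]
    calc katoLambda W p k r w₀ Ψ hΨ hw₀ g hg dw hinjw hexw y
        = ((q : ℚ_[p]) * ((q⁻¹ : ℚ) : ℚ_[p])) • katoLambda W p k r w₀ Ψ hΨ hw₀ g hg dw hinjw hexw y := by
          rw [hqq, one_smul]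
      _ = (q : ℚ_[p]) • (((q⁻¹ : ℚ) : ℚ_[p]) • katoLambda W p k r w₀ Ψ hΨ hw₀ g hg dw hinjw hexw y) := mul_smul _ _ _
      _ = (q : ℚ_[p]) • ((1 : ℚ_[p]) ⊗ₜ[ℚ] x) := by rw [hy]
      _ = (1 : ℚ_[p]) ⊗ₜ[ℚ] (q • x) := by
          rw [TensorProduct.tmul_smul, ← algebraMap_smul ℚ_[p] q, Algebra.algebraMap_eq_smul_one, Rat.smul_one_eq_cast]

end Summit.BirchSwinnertonDyer.BirchSwinnertonDyer.Theorems.KimAtThreeFineKatoDefinedLambdaRescale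

end
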